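import Literature.MathematicalPhysics.QuantumFieldTheory.Balaban1983to89.B4CubeGreenRegionPair

/-!
# `Balaban1983to89.B4PairLetterL2` — [Balaban1983RegularityDecay] THEOREM p. 573, (1.11)–(1.12) FOR A GENERAL PAIR
# `Ω ⊂ Ω₀`: LEMMA 2.1's `‖·‖_{2,η}` LETTER OF THE DOUBLY-CUT CUBE PROPAGATOR at a cube meeting `∂Ω` is the direct sum of
# the letters of `Ω ∩ □̂_j` and `(Ω₀∖Ω) ∩ □̂_j`, so its `ℓ²→ℓ²` bound is the larger of the two Lemma-2.1 bounds

statement-level skeleton of published theorems with citation tags; proofs where landed; nothing here is a claim about the Yang–Mills mass gap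

WHAT THIS FILE DOES.  §1 two-block `ℓ²` bookkeeping on a general carrier: `mulH_split` (a multiplication operator is
the sum of its two paddings), `sum_split` (a sum over `X` splits over the two images), **`lpv_two_padSum_le`** (if
`‖B₁g‖₂ ≤ β‖g‖₂` and `‖B₂g‖₂ ≤ β‖g‖₂` on the two pieces then `‖(pad B₁ + pad B₂)g‖₂ ≤ β‖g‖₂`).  §2 the letter
`K·(pad G₁ + pad G₂)·h` of the operator (1.6) cut across `∂S` splits: **`letter_cut_split`**
`= pad_{e₁}(K₁G₁h₁) + pad_{e₂}(K₂G₂h₂)` (from `B4RegionPairGreen.covOp_cut_eq_pad_add_pad`).  §3 the pair of regions: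
**`lpv_two_letterΩ_bad_le`** — at a cube `□̂_j ⊄ Ω` the `‖·‖₂` letter bound `β` of the second family
`K_j^ΩG_j^Ωh_j` (`B4CubeGreenRegionPair.atGreenΩ`) follows from the two sub-region letter bounds (Lemma 2.1 (2.21) on
`Ω ∩ □̂_j` and on `(Ω₀∖Ω) ∩ □̂_j` with the configuration `A`), the input `h2Ω` of r01 g6's
`B4Ineq112LpChain.ineq112_value_lp` at those cubes.

HONEST SCOPE.  Bookkeeping only; the two Lemma-2.1 bounds are hypotheses here (discharged downstream by
`B4Eq221HjRegion.eq221_l2_region_hZ`).  No `Prop` fact, no `sorry`; axioms standard.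
-/

namespace Literature.MathematicalPhysics.QuantumFieldTheory.Balaban1983to89.B4PairLetterL2

open Literature.MathematicalPhysics.QuantumFieldTheory.Balaban1983to89.B4Reflection242 (boxDom blk)
open Literature.MathematicalPhysics.QuantumFieldTheory.Balaban1983to89.B4GaugeCovariance
open Literature.MathematicalPhysics.QuantumFieldTheory.Balaban1983to89.B4Commutators25to211 (mulH opK)
open Literature.MathematicalPhysics.QuantumFieldTheory.Balaban1983to89.B4Ineq110WalkRoute (mulH_apply)
open Literature.MathematicalPhysics.QuantumFieldTheory.Balaban1983to89.B4Lower18 (fineDom mem_fineDom)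
open Literature.MathematicalPhysics.QuantumFieldTheory.Balaban1983to89.B4Lower18RegularRegion (regWt rBlkWt rbaseEmb
  rstairContour regWt_nonneg compField)
open Literature.MathematicalPhysics.QuantumFieldTheory.Balaban1983to89.B4Eq221L2FactorRegion (acBond)
open Literature.MathematicalPhysics.QuantumFieldTheory.Balaban1983to89.B4CubeOpReindex
open Literature.MathematicalPhysics.QuantumFieldTheory.Balaban1983to89.B4RegionCubeCarrier
open Literature.MathematicalPhysics.QuantumFieldTheory.Balaban1983to89.B4CubeGreenRegion
open Literature.MathematicalPhysics.QuantumFieldTheory.Balaban1983to89.B4LpNormTransfer (pad_mulVec_apply_off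
  lpv_pad_mulVec lpv_res_le lpv_bound_of_lpW_bound)
open Literature.MathematicalPhysics.QuantumFieldTheory.Balaban1983to89.B4PartitionUnity22 (hCube)
open Literature.MathematicalPhysics.QuantumFieldTheory.Balaban1983to89.B4Eq220PartitionSizes (hZ)
open Literature.MathematicalPhysics.QuantumFieldTheory.Balaban1983to89.B4Lemma22EtaBox (vol vol_pos lpW)
open Literature.MathematicalPhysics.QuantumFieldTheory.Balaban1983to89.B4WalkRouteRegion (rpos)
open Literature.MathematicalPhysics.QuantumFieldTheory.Balaban1983to89.B4RegionCubeCarrier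
open Literature.MathematicalPhysics.QuantumFieldTheory.Balaban1983to89.B4RegionPairGreen
open Literature.MathematicalPhysics.QuantumFieldTheory.Balaban1983to89.B4CubeGreenRegionPair
open Literature.MathematicalPhysics.QuantumFieldTheory.Balaban1983to89.B4Ineq110LpChain (lpv lpv_nonneg lpv_two_eq_sqrt)
open scoped Matrix

noncomputable section

/-! ## §1. Two-block `ℓ²` bookkeeping -/

section TwoBlocks

variable {X X₁ X₂ κ : Type} [Fintype X] [Fintype X₁] [Fintype X₂] [Fintype κ] [DecidableEq X]
variable (S : X → Prop) [DecidablePred S] {e₁ : X₁ → X} {e₂ : X₂ → X}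

omit [Fintype X] [Fintype κ] in
/-- a multiplication operator is the sum of its paddings on the two pieces. [cite: Balaban1983RegularityDecay, (2.2) p.575, dictionary] -/
theorem mulH_split [DecidableEq κ] [DecidableEq X₁] [DecidableEq X₂] (he₁ : Function.Injective e₁)
    (hS₁ : ∀ z, S z ↔ ∃ a, e₁ a = z)
    (he₂ : Function.Injective e₂) (hS₂ : ∀ z, ¬ S z ↔ ∃ b, e₂ b = z) (h : X → ℝ) :
    mulH (ι := κ) h = pad e₁ (mulH (ι := κ) fun a => h (e₁ a)) + pad e₂ (mulH (ι := κ) fun b => h (e₂ b)) := by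
  have h12 : ∀ a b, e₁ a ≠ e₂ b := fun a b hab => ((hS₂ _).mpr ⟨b, rfl⟩) ((hS₁ _).mpr ⟨a, hab⟩)
  ext p p'
  rw [Matrix.add_apply, mulH_apply]
  by_cases hp : S p.1
  · obtain ⟨a, ha⟩ := (hS₁ _).mp hp
    rw [pad_apply_of_left e₂ _ (fun b hb => h12 a b (ha.trans hb.symm)), add_zero]
    by_cases hp' : ∃ a', e₁ a' = p'.1
    · obtain ⟨a', ha'⟩ := hp'
      obtain ⟨z, k⟩ := p
      obtain ⟨z', k'⟩ := p'
      simp only at ha ha'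
      subst ha; subst ha'
      rw [pad_apply_img he₁, mulH_apply]
      by_cases hh : (a, k) = (a', k')
      · obtain ⟨rfl, rfl⟩ := Prod.mk.inj hh
        simp
      · rw [if_neg hh, if_neg]
        intro h'
        obtain ⟨h1, h2⟩ := Prod.mk.inj h'
        exact hh (by rw [he₁ h1, h2])
    · rw [pad_apply_of_right e₁ _ p (fun a' h' => hp' ⟨a', h'⟩), if_neg]
      rintro rfl
      exact hp' ⟨a, ha⟩
  · obtain ⟨b, hb⟩ := (hS₂ _).mp hp
    rw [pad_apply_of_left e₁ _ (fun a ha => h12 a b (ha.trans hb.symm)), zero_add]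
    by_cases hp' : ∃ b', e₂ b' = p'.1
    · obtain ⟨b', hb'⟩ := hp'
      obtain ⟨z, k⟩ := p
      obtain ⟨z', k'⟩ := p'
      simp only at hb hb'
      subst hb; subst hb'
      rw [pad_apply_img he₂, mulH_apply]
      by_cases hh : (b, k) = (b', k')
      · obtain ⟨rfl, rfl⟩ := Prod.mk.inj hh
        simp
      · rw [if_neg hh, if_neg]
        intro h'
        obtain ⟨h1, h2⟩ := Prod.mk.inj h'
        exact hh (by rw [he₂ h1, h2])
    · rw [pad_apply_of_right e₂ _ p (fun b' h' => hp' ⟨b', h'⟩), if_neg]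
      rintro rfl
      exact hp' ⟨b, hb⟩

omit [Fintype X₁] [Fintype X₂] [Fintype κ] [DecidableEq X] in
/-- a sum over `X` is the sum over the two pieces. [folklore] -/
private theorem sum_split (he₁ : Function.Injective e₁) (hS₁ : ∀ z, S z ↔ ∃ a, e₁ a = z)
    (he₂ : Function.Injective e₂) (hS₂ : ∀ z, ¬ S z ↔ ∃ b, e₂ b = z) [Fintype X₁] [Fintype X₂] (f : X → ℝ) :
    ∑ z, f z = ∑ a, f (e₁ a) + ∑ b, f (e₂ b) := by
  classical
  have h1 : ∑ a, f (e₁ a) = ∑ z ∈ Finset.univ.filter (fun z => S z), f z := by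
    rw [← Finset.sum_image (f := f) (s := Finset.univ) (g := e₁) (fun a _ b _ h => he₁ h)]
    refine Finset.sum_congr ?_ fun _ _ => rfl
    ext z
    simp only [Finset.mem_image, Finset.mem_univ, true_and, Finset.mem_filter]
    exact ⟨fun h => (hS₁ z).mpr h, fun h => (hS₁ z).mp h⟩
  have h2 : ∑ b, f (e₂ b) = ∑ z ∈ Finset.univ.filter (fun z => ¬ S z), f z := by
    rw [← Finset.sum_image (f := f) (s := Finset.univ) (g := e₂) (fun a _ b _ h => he₂ h)]
    refine Finset.sum_congr ?_ fun _ _ => rfl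
    ext z
    simp only [Finset.mem_image, Finset.mem_univ, true_and, Finset.mem_filter]
    exact ⟨fun h => (hS₂ z).mpr h, fun h => (hS₂ z).mp h⟩
  rw [h1, h2, Finset.sum_filter_add_sum_filter_not]

omit [DecidableEq X] in
/-- `‖g‖₂² = w·Σ g²`. [cite: Balaban1983RegularityDecay, (2.21) p.578] -/
theorem lpv_two_sq {m : Type} [Fintype m] {w : ℝ} (hw : 0 ≤ w) (g : m → ℝ) :
    lpv w 2 g ^ 2 = w * ∑ z, g z ^ 2 := by
  rw [lpv_two_eq_sqrt, Real.sq_sqrt (mul_nonneg hw (Finset.sum_nonneg fun _ _ => sq_nonneg _))]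

/-- **`‖(pad B₁ + pad B₂)g‖₂ ≤ β‖g‖₂`** from `‖B₁g₁‖₂ ≤ β‖g₁‖₂`, `‖B₂g₂‖₂ ≤ β‖g₂‖₂` on the two pieces (disjoint
supports add in `ℓ²`). [cite: Balaban1983RegularityDecay, (2.21) p.578, (1.11) p.573] -/
theorem lpv_two_padSum_le (he₁ : Function.Injective e₁) (hS₁ : ∀ z, S z ↔ ∃ a, e₁ a = z)
    (he₂ : Function.Injective e₂) (hS₂ : ∀ z, ¬ S z ↔ ∃ b, e₂ b = z) {w β : ℝ} (hw : 0 ≤ w) (hβ : 0 ≤ β)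
    (B₁ : Matrix (X₁ × κ) (X₁ × κ) ℝ) (B₂ : Matrix (X₂ × κ) (X₂ × κ) ℝ)
    (h₁ : ∀ g₁ : X₁ × κ → ℝ, lpv w 2 (B₁ *ᵥ g₁) ≤ β * lpv w 2 g₁)
    (h₂ : ∀ g₂ : X₂ × κ → ℝ, lpv w 2 (B₂ *ᵥ g₂) ≤ β * lpv w 2 g₂) (g : X × κ → ℝ) :
    lpv w 2 ((pad e₁ B₁ + pad e₂ B₂) *ᵥ g) ≤ β * lpv w 2 g := by
  have h12 : ∀ a b, e₁ a ≠ e₂ b := fun a b hab => ((hS₂ _).mpr ⟨b, rfl⟩) ((hS₁ _).mpr ⟨a, hab⟩)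
  set u := pad e₁ B₁ *ᵥ g with hu
  set v := pad e₂ B₂ *ᵥ g with hv
  set g₁ : X₁ × κ → ℝ := fun q => g (e₁ q.1, q.2) with hg₁
  set g₂ : X₂ × κ → ℝ := fun q => g (e₂ q.1, q.2) with hg₂
  -- squares split over the two pieces
  have hsq : lpv w 2 (u + v) ^ 2 = lpv w 2 u ^ 2 + lpv w 2 v ^ 2 := by
    rw [lpv_two_sq hw, lpv_two_sq hw, lpv_two_sq hw, ← mul_add]
    congr 1
    rw [Fintype.sum_prod_type, Fintype.sum_prod_type, Fintype.sum_prod_type,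
      sum_split S he₁ hS₁ he₂ hS₂ (fun z => ∑ i, (u + v) (z, i) ^ 2),
      sum_split S he₁ hS₁ he₂ hS₂ (fun z => ∑ i, u (z, i) ^ 2),
      sum_split S he₁ hS₁ he₂ hS₂ (fun z => ∑ i, v (z, i) ^ 2)]
    have hv0 : ∀ a i, v (e₁ a, i) = 0 := fun a i =>
      pad_mulVec_apply_off e₂ B₂ g (p := (e₁ a, i)) (fun b hb => h12 a b hb.symm)
    have hu0 : ∀ b i, u (e₂ b, i) = 0 := fun b i =>
      pad_mulVec_apply_off e₁ B₁ g (p := (e₂ b, i)) (fun a ha => h12 a b ha)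
    simp only [Pi.add_apply, hv0, hu0, add_zero, zero_add]
    simp
  have hgsq : lpv w 2 g₁ ^ 2 + lpv w 2 g₂ ^ 2 = lpv w 2 g ^ 2 := by
    rw [lpv_two_sq hw, lpv_two_sq hw, lpv_two_sq hw, ← mul_add]
    congr 1
    rw [Fintype.sum_prod_type, Fintype.sum_prod_type, Fintype.sum_prod_type,
      sum_split S he₁ hS₁ he₂ hS₂ (fun z => ∑ i, g (z, i) ^ 2)]
  have hu' : lpv w 2 u ≤ β * lpv w 2 g₁ := by rw [hu, lpv_pad_mulVec he₁ two_pos]; exact h₁ g₁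
  have hv' : lpv w 2 v ≤ β * lpv w 2 g₂ := by rw [hv, lpv_pad_mulVec he₂ two_pos]; exact h₂ g₂
  have hU := lpv_nonneg hw 2 u
  have hV := lpv_nonneg hw 2 v
  have hG := lpv_nonneg hw 2 g
  have hsq_le : lpv w 2 (u + v) ^ 2 ≤ (β * lpv w 2 g) ^ 2 := by
    rw [hsq, mul_pow, ← hgsq, mul_add]
    have h1 : lpv w 2 u ^ 2 ≤ β ^ 2 * lpv w 2 g₁ ^ 2 := by
      rw [← mul_pow]; exact pow_le_pow_left₀ hU hu' 2
    have h2 : lpv w 2 v ^ 2 ≤ β ^ 2 * lpv w 2 g₂ ^ 2 := by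
      rw [← mul_pow]; exact pow_le_pow_left₀ hV hv' 2
    exact add_le_add h1 h2
  rw [Matrix.add_mulVec]
  exact (pow_le_pow_iff_left₀ (lpv_nonneg hw 2 (u + v)) (mul_nonneg hβ hG) two_ne_zero).mp hsq_le

/-! ## §2. The letter of the cut operator splits over the two pieces -/

/-- **`K_h·(pad G₁ + pad G₂)·h = pad_{e₁}(K₁G₁h₁) + pad_{e₂}(K₂G₂h₂)`**: the commutator (2.10) of the operator (1.6) cut
across `∂S` with `h`, times the direct sum of two operators on the pieces, times `h`, is the direct sum of the two
letters (bonds across `∂S` are cut, no averaging block straddles `∂S`). [cite: Balaban1983RegularityDecay, (2.10)–(2.11) p.576, (1.11) p.573] -/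
theorem letter_cut_split {Y Y₁ Y₂ : Type} [Fintype Y] [Fintype Y₁] [Fintype Y₂] [DecidableEq X₁] [DecidableEq X₂]
    [DecidableEq κ] {eY₁ : Y₁ → Y} {eY₂ : Y₂ → Y}
    (he₁ : Function.Injective e₁) (hS₁ : ∀ z, S z ↔ ∃ a, e₁ a = z)
    (he₂ : Function.Injective e₂) (hS₂ : ∀ z, ¬ S z ↔ ∃ b, e₂ b = z)
    (heY₁ : Function.Injective eY₁) (heY₂ : Function.Injective eY₂)
    (c : X → X → ℝ) (m2 a : ℝ) (q : Y → X → ℝ) (W : X → X → Matrix κ κ ℝ) (T : Y → X → Matrix κ κ ℝ)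
    (hq₁ : ∀ y a', q y (e₁ a') ≠ 0 → ∃ y', eY₁ y' = y) (hq₂ : ∀ y b, q y (e₂ b) ≠ 0 → ∃ y', eY₂ y' = y)
    (hSq : ∀ y z z', q y z ≠ 0 → q y z' ≠ 0 → (S z ↔ S z')) (h : X → ℝ)
    (G₁ : Matrix (X₁ × κ) (X₁ × κ) ℝ) (G₂ : Matrix (X₂ × κ) (X₂ × κ) ℝ) :
    opK (cutWt S c) m2 a q W T h * (pad e₁ G₁ + pad e₂ G₂) * mulH (ι := κ) h
      = pad e₁ (opK (fun b b' => c (e₁ b) (e₁ b')) m2 a (fun y' b => q (eY₁ y') (e₁ b))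
            (fun b b' => W (e₁ b) (e₁ b')) (fun y' b => T (eY₁ y') (e₁ b)) (fun b => h (e₁ b))
          * G₁ * mulH (ι := κ) (fun b => h (e₁ b)))
        + pad e₂ (opK (fun b b' => c (e₂ b) (e₂ b')) m2 a (fun y' b => q (eY₂ y') (e₂ b))
            (fun b b' => W (e₂ b) (e₂ b')) (fun y' b => T (eY₂ y') (e₂ b)) (fun b => h (e₂ b))
          * G₂ * mulH (ι := κ) (fun b => h (e₂ b))) := by
  have h12 : ∀ a b, e₁ a ≠ e₂ b := fun a b hab => ((hS₂ _).mpr ⟨b, rfl⟩) ((hS₁ _).mpr ⟨a, hab⟩)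
  have h21 : ∀ b a, e₂ b ≠ e₁ a := fun b a hba => h12 a b hba.symm
  unfold opK
  rw [covOp_cut_eq_pad_add_pad S he₁ hS₁ he₂ hS₂ heY₁ heY₂ c m2 a q W T hq₁ hq₂ hSq,
    mulH_split S he₁ hS₁ he₂ hS₂ h]
  simp only [Matrix.add_mul, Matrix.mul_add, Matrix.sub_mul, pad_mul he₁, pad_mul he₂,
    pad_mul_pad_of_disjoint h12, pad_mul_pad_of_disjoint h21, add_zero, zero_add, sub_zero, pad_sub, Matrix.mul_assoc]

end TwoBlocks

/-! ## §3. The pair of regions: Lemma 2.1's letter bound for `G_j^Ω` at a cube meeting `∂Ω` -/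

section Pair

variable {d : ℕ} {ι : Type} [Fintype ι] [DecidableEq ι] (F : OrthFlow ι) (κ : ℝ)
variable (ℓ k : ℕ) (Ω₀c Ωc : Finset (Fin (d + 1) → ℤ)) (hsub : Ωc ⊆ Ω₀c) (K : ℕ)
  (Ac : (Fin (d + 1) → ℤ) → Fin (d + 1) → ℝ)

/-- the mesh `n = L^k ≥ 1`. [folklore] -/
private theorem one_le_n : 1 ≤ (ℓ + 1) ^ k := Nat.one_le_pow _ _ (Nat.succ_pos ℓ)

/-- **THE SUB-SUB-REGION LETTER READ THROUGH TWO INCLUSIONS** is Lemma 2.1's letter `K_{h_j}G_k(R,A)h_j` of the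
region `R ⊆ Ω₀ ∩ □̂_j` with the configuration `A` and p35's weight `hZ`. [cite: Balaban1983RegularityDecay, (2.11) p.576, (2.21) p.578] -/
theorem letter_incl_eq (m2 a : ℝ) (j : Fin (d + 1) → ℤ) {R : Finset (Fin (d + 1) → ℤ)} (hR : R ⊆ subLabels Ω₀c K j) :
    opK (fun b b' => regWt ((ℓ + 1) ^ k) (fineDom ((ℓ + 1) ^ k) (subLabels Ω₀c K j))
          (incl (one_le_n ℓ k) hR b) (incl (one_le_n ℓ k) hR b')) m2 (B1.aSeq a ((ℓ : ℝ) + 1) k * (((((ℓ + 1) ^ k : ℕ)) : ℝ) ^ (d + 1))⁻¹)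
        (fun y' b => rBlkWt ((ℓ + 1) ^ k) (subLabels Ω₀c K j) (fineDom ((ℓ + 1) ^ k) (subLabels Ω₀c K j))
          (inclY hR y') (incl (one_le_n ℓ k) hR b))
        (fun b b' => fieldLink F κ (fun u v : ↥(fineDom ((ℓ + 1) ^ k) (subLabels Ω₀c K j)) => compField Ac u.1 v.1)
          (incl (one_le_n ℓ k) hR b) (incl (one_le_n ℓ k) hR b'))
        (fun y' b => contourTrans
          (fieldLink F κ (fun u v : ↥(fineDom ((ℓ + 1) ^ k) (subLabels Ω₀c K j)) => compField Ac u.1 v.1))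
          (rbaseEmb (one_le_n ℓ k) (subLabels Ω₀c K j)) (rstairContour (one_le_n ℓ k) (subLabels Ω₀c K j))
          (inclY hR y') (incl (one_le_n ℓ k) hR b))
        (fun b => hCube ((((ℓ + 1) ^ k : ℕ) : ℝ) * K) j (rpos ((ℓ + 1) ^ k) Ω₀c
          (incl (one_le_n ℓ k) (subLabels_subset Ω₀c K j) (incl (one_le_n ℓ k) hR b))))
      * (regOp F κ (one_le_n ℓ k) R m2 (B1.aSeq a ((ℓ : ℝ) + 1) k * (((((ℓ + 1) ^ k : ℕ)) : ℝ) ^ (d + 1))⁻¹) (compField Ac))⁻¹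
      * mulH (ι := ι) (fun b => hCube ((((ℓ + 1) ^ k : ℕ) : ℝ) * K) j (rpos ((ℓ + 1) ^ k) Ω₀c
          (incl (one_le_n ℓ k) (subLabels_subset Ω₀c K j) (incl (one_le_n ℓ k) hR b))))
      = opK (regWt ((ℓ + 1) ^ k) (fineDom ((ℓ + 1) ^ k) R)) m2 (B1.aSeq a ((ℓ : ℝ) + 1) k * (((((ℓ + 1) ^ k : ℕ)) : ℝ) ^ (d + 1))⁻¹)
            (rBlkWt ((ℓ + 1) ^ k) R (fineDom ((ℓ + 1) ^ k) R))
            (fieldLink F κ (acBond R Ac))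
            (contourTrans (fieldLink F κ (acBond R Ac)) (rbaseEmb (one_le_n ℓ k) R) (rstairContour (one_le_n ℓ k) R))
            (fun a : ↥(fineDom ((ℓ + 1) ^ k) R) => hZ ((ℓ + 1) ^ k) K j a.1)
        * (covOp (regWt ((ℓ + 1) ^ k) (fineDom ((ℓ + 1) ^ k) R)) m2 (B1.aSeq a ((ℓ : ℝ) + 1) k * (((((ℓ + 1) ^ k : ℕ)) : ℝ) ^ (d + 1))⁻¹)
            (rBlkWt ((ℓ + 1) ^ k) R (fineDom ((ℓ + 1) ^ k) R))
            (fieldLink F κ (acBond R Ac))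
            (contourTrans (fieldLink F κ (acBond R Ac)) (rbaseEmb (one_le_n ℓ k) R) (rstairContour (one_le_n ℓ k) R)))⁻¹
        * mulH (ι := ι) (fun a : ↥(fineDom ((ℓ + 1) ^ k) R) => hZ ((ℓ + 1) ^ k) K j a.1) := by
  have hT : (fun y' b => contourTrans
      (fieldLink F κ (fun u v : ↥(fineDom ((ℓ + 1) ^ k) (subLabels Ω₀c K j)) => compField Ac u.1 v.1))
      (rbaseEmb (one_le_n ℓ k) (subLabels Ω₀c K j)) (rstairContour (one_le_n ℓ k) (subLabels Ω₀c K j))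
      (inclY hR y') (incl (one_le_n ℓ k) hR b))
      = contourTrans (fieldLink F κ (acBond R Ac)) (rbaseEmb (one_le_n ℓ k) R) (rstairContour (one_le_n ℓ k) R) := by
    funext y' b
    exact contourTrans_incl (one_le_n ℓ k) hR F κ _ y' b
  have hh : (fun b : ↥(fineDom ((ℓ + 1) ^ k) R) => hCube ((((ℓ + 1) ^ k : ℕ) : ℝ) * K) j (rpos ((ℓ + 1) ^ k) Ω₀c
      (incl (one_le_n ℓ k) (subLabels_subset Ω₀c K j) (incl (one_le_n ℓ k) hR b))))
      = fun a : ↥(fineDom ((ℓ + 1) ^ k) R) => hZ ((ℓ + 1) ^ k) K j a.1 :=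
    funext fun b => hCube_rpos_eq_hZ _ K j _
  rw [hT, hh]
  rfl

/-- **THE INPUT `h2Ω` AT A CUBE MEETING `∂Ω` (or outside `Ω`)**: if Lemma 2.1's `‖·‖_{2,η}` letters of the sub-regions
`Ω ∩ □̂_j` and `(Ω₀∖Ω) ∩ □̂_j` (configuration `A`, weight `h_j`) are bounded by `c_K`, then the letter
`K_j^ΩG_j^Ωh_j` of the second family obeys `‖K_j^ΩG_j^Ωh_j g‖_{2,η} ≤ √N c_K‖g‖_{2,η}` (entrywise weighted norms of
r01 g6's chain). [cite: Balaban1983RegularityDecay, (2.21) p.578, (1.11) p.573, Lemma 2.1 p.577] -/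
theorem lpv_two_letterΩ_bad_le {a m2 : ℝ} {j : Fin (d + 1) → ℤ} (hK1 : 1 ≤ K) (hb : ¬ cubeLabels K j ⊆ Ωc)
    {cK : ℝ} (hcK : 0 ≤ cK)
    (h₁ : ∀ Φ : ↥(fineDom ((ℓ + 1) ^ k) (Ωc ∩ cubeLabels K j)) × ι → ℝ,
      lpW d ℓ k 2 (opK (regWt ((ℓ + 1) ^ k) (fineDom ((ℓ + 1) ^ k) (Ωc ∩ cubeLabels K j))) m2 (B1.aSeq a ((ℓ : ℝ) + 1) k * (((((ℓ + 1) ^ k : ℕ)) : ℝ) ^ (d + 1))⁻¹)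
            (rBlkWt ((ℓ + 1) ^ k) (Ωc ∩ cubeLabels K j) (fineDom ((ℓ + 1) ^ k) (Ωc ∩ cubeLabels K j)))
            (fieldLink F κ (acBond (Ωc ∩ cubeLabels K j) Ac))
            (contourTrans (fieldLink F κ (acBond (Ωc ∩ cubeLabels K j) Ac)) (rbaseEmb (one_le_n ℓ k) (Ωc ∩ cubeLabels K j))
              (rstairContour (one_le_n ℓ k) (Ωc ∩ cubeLabels K j)))
            (fun a : ↥(fineDom ((ℓ + 1) ^ k) (Ωc ∩ cubeLabels K j)) => hZ ((ℓ + 1) ^ k) K j a.1)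
          *ᵥ ((covOp (regWt ((ℓ + 1) ^ k) (fineDom ((ℓ + 1) ^ k) (Ωc ∩ cubeLabels K j))) m2 (B1.aSeq a ((ℓ : ℝ) + 1) k * (((((ℓ + 1) ^ k : ℕ)) : ℝ) ^ (d + 1))⁻¹)
                (rBlkWt ((ℓ + 1) ^ k) (Ωc ∩ cubeLabels K j) (fineDom ((ℓ + 1) ^ k) (Ωc ∩ cubeLabels K j)))
                (fieldLink F κ (acBond (Ωc ∩ cubeLabels K j) Ac))
                (contourTrans (fieldLink F κ (acBond (Ωc ∩ cubeLabels K j) Ac)) (rbaseEmb (one_le_n ℓ k) (Ωc ∩ cubeLabels K j))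
                  (rstairContour (one_le_n ℓ k) (Ωc ∩ cubeLabels K j))))⁻¹
            *ᵥ (mulH (ι := ι) (fun a : ↥(fineDom ((ℓ + 1) ^ k) (Ωc ∩ cubeLabels K j)) => hZ ((ℓ + 1) ^ k) K j a.1) *ᵥ Φ))) ≤ cK * lpW d ℓ k 2 Φ)
    (h₂ : ∀ Φ : ↥(fineDom ((ℓ + 1) ^ k) (subLabels Ω₀c K j \ (Ωc ∩ cubeLabels K j))) × ι → ℝ,
      lpW d ℓ k 2 (opK (regWt ((ℓ + 1) ^ k) (fineDom ((ℓ + 1) ^ k) (subLabels Ω₀c K j \ (Ωc ∩ cubeLabels K j)))) m2 (B1.aSeq a ((ℓ : ℝ) + 1) k * (((((ℓ + 1) ^ k : ℕ)) : ℝ) ^ (d + 1))⁻¹)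
            (rBlkWt ((ℓ + 1) ^ k) (subLabels Ω₀c K j \ (Ωc ∩ cubeLabels K j)) (fineDom ((ℓ + 1) ^ k) (subLabels Ω₀c K j \ (Ωc ∩ cubeLabels K j))))
            (fieldLink F κ (acBond (subLabels Ω₀c K j \ (Ωc ∩ cubeLabels K j)) Ac))
            (contourTrans (fieldLink F κ (acBond (subLabels Ω₀c K j \ (Ωc ∩ cubeLabels K j)) Ac)) (rbaseEmb (one_le_n ℓ k) (subLabels Ω₀c K j \ (Ωc ∩ cubeLabels K j)))
              (rstairContour (one_le_n ℓ k) (subLabels Ω₀c K j \ (Ωc ∩ cubeLabels K j))))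
            (fun a : ↥(fineDom ((ℓ + 1) ^ k) (subLabels Ω₀c K j \ (Ωc ∩ cubeLabels K j))) => hZ ((ℓ + 1) ^ k) K j a.1)
          *ᵥ ((covOp (regWt ((ℓ + 1) ^ k) (fineDom ((ℓ + 1) ^ k) (subLabels Ω₀c K j \ (Ωc ∩ cubeLabels K j)))) m2 (B1.aSeq a ((ℓ : ℝ) + 1) k * (((((ℓ + 1) ^ k : ℕ)) : ℝ) ^ (d + 1))⁻¹)
                (rBlkWt ((ℓ + 1) ^ k) (subLabels Ω₀c K j \ (Ωc ∩ cubeLabels K j)) (fineDom ((ℓ + 1) ^ k) (subLabels Ω₀c K j \ (Ωc ∩ cubeLabels K j))))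
                (fieldLink F κ (acBond (subLabels Ω₀c K j \ (Ωc ∩ cubeLabels K j)) Ac))
                (contourTrans (fieldLink F κ (acBond (subLabels Ω₀c K j \ (Ωc ∩ cubeLabels K j)) Ac)) (rbaseEmb (one_le_n ℓ k) (subLabels Ω₀c K j \ (Ωc ∩ cubeLabels K j)))
                  (rstairContour (one_le_n ℓ k) (subLabels Ω₀c K j \ (Ωc ∩ cubeLabels K j)))))⁻¹
            *ᵥ (mulH (ι := ι) (fun a : ↥(fineDom ((ℓ + 1) ^ k) (subLabels Ω₀c K j \ (Ωc ∩ cubeLabels K j))) => hZ ((ℓ + 1) ^ k) K j a.1) *ᵥ Φ))) ≤ cK * lpW d ℓ k 2 Φ)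
    (g : ↥(fineDom ((ℓ + 1) ^ k) Ω₀c) × ι → ℝ) :
    lpv (vol d ℓ k)⁻¹ 2
        ((opK (cutWt (cubeS ℓ k Ω₀c K j) (cOmega ℓ k Ω₀c Ωc)) m2 (B1.aSeq a ((ℓ : ℝ) + 1) k * (((((ℓ + 1) ^ k : ℕ)) : ℝ) ^ (d + 1))⁻¹)
            (rBlkWt ((ℓ + 1) ^ k) Ω₀c (fineDom ((ℓ + 1) ^ k) Ω₀c))
            (cubeW F κ ℓ k Ω₀c K (atField₂ ℓ k Ω₀c Ωc K Ac j) j) (cubeT F κ ℓ k Ω₀c K (atField₂ ℓ k Ω₀c Ωc K Ac j) j)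
            (fun z => hCube ((((ℓ + 1) ^ k : ℕ) : ℝ) * K) j (rpos ((ℓ + 1) ^ k) Ω₀c z))
          * atGreenΩ F κ ℓ k Ω₀c Ωc hsub K Ac a m2 j
          * mulH (ι := ι) (fun z => hCube ((((ℓ + 1) ^ k : ℕ) : ℝ) * K) j (rpos ((ℓ + 1) ^ k) Ω₀c z))) *ᵥ g)
      ≤ Real.sqrt (Fintype.card ι) * cK * lpv (vol d ℓ k)⁻¹ 2 g := by
  have hn := one_le_n ℓ k
  have hw : (0 : ℝ) ≤ (vol d ℓ k)⁻¹ := inv_nonneg.2 (vol_pos d ℓ k).le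
  have hN : (0 : ℝ) ≤ Real.sqrt (Fintype.card ι) := Real.sqrt_nonneg _
  have hsupp : ∀ z : ↥(fineDom ((ℓ + 1) ^ k) Ω₀c),
      hCube ((((ℓ + 1) ^ k : ℕ) : ℝ) * K) j (rpos ((ℓ + 1) ^ k) Ω₀c z) ≠ 0 → cubeS ℓ k Ω₀c K j z :=
    fun z hz => cubeS_of_hCube_ne_zero ℓ k Ω₀c hK1 j z hz
  -- the sub-pair on the cube
  have hR₁ : Ωc ∩ cubeLabels K j ⊆ subLabels Ω₀c K j := inter_subset_subLabels Ω₀c Ωc K hsub j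
  have hR₂ : subLabels Ω₀c K j \ (Ωc ∩ cubeLabels K j) ⊆ subLabels Ω₀c K j := Finset.sdiff_subset
  have he₁ := incl_injective hn hR₁
  have he₂ := incl_injective hn hR₂
  have hS₁ := fun x => inReg_iff hn hR₁ x
  have hS₂ := fun x => not_inReg_iff hn (subLabels Ω₀c K j) (Ωc ∩ cubeLabels K j) x
  rw [letterΩ_b_bad F κ ℓ k Ω₀c Ωc hsub K Ac a m2 hb _ hsupp, lpv_pad_mulVec (incl_injective hn _) two_pos,
    pairGreen,
    letter_cut_split (inReg ((ℓ + 1) ^ k) (Ωc ∩ cubeLabels K j)) he₁ hS₁ he₂ hS₂ (inclY_injective hR₁)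
      (inclY_injective hR₂) _ m2 _ _ _ _ (fun y b h => rBlkWt_incl_ne_zero hn hR₁ h)
      (fun y b h => rBlkWt_incl_ne_zero hn hR₂ h) (fun y z z' h h' => inReg_iff_of_rBlkWt h h'),
    letter_incl_eq F κ ℓ k Ω₀c K Ac m2 a j hR₁, letter_incl_eq F κ ℓ k Ω₀c K Ac m2 a j hR₂]
  refine (lpv_two_padSum_le (inReg ((ℓ + 1) ^ k) (Ωc ∩ cubeLabels K j)) he₁ hS₁ he₂ hS₂ hw (mul_nonneg hN hcK)
    _ _ (fun g₁ => ?_) (fun g₂ => ?_) _).trans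
    (mul_le_mul_of_nonneg_left (lpv_res_le (incl_injective hn _) hw two_pos g) (mul_nonneg hN hcK))
  · have hin := h₁ g₁
    rw [Matrix.mulVec_mulVec, Matrix.mulVec_mulVec] at hin
    exact lpv_bound_of_lpW_bound d ℓ k two_pos le_rfl hcK hin
  · have hin := h₂ g₂
    rw [Matrix.mulVec_mulVec, Matrix.mulVec_mulVec] at hin
    exact lpv_bound_of_lpW_bound d ℓ k two_pos le_rfl hcK hin

end Pair

end

end Literature.MathematicalPhysics.QuantumFieldTheory.Balaban1983to89.B4PairLetterL2
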